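import Summits.QuantumFields.YangMills.Theorems.SwapVirialDeficitZeroModeGroupFourSmallBallRadial
import Summits.QuantumFields.YangMills.Theorems.SwapVirialDeficitZeroModeGroupFourSmallBallDecay
import HarnessLib

/-!
# Exact zero-mode rung, FOUR pairwise nearly commuting letters — X: the three regional estimates of the radial integral
# (zero-mode block of crux ⟨stmt-QuantumFields-24497⟩ `ToronTubeVolumeLaw`; free-hands support of ⟨stmt-QuantumFields-24197⟩ / ⟨24497⟩)

By part VII, `Haar⁴(N₄(t)) = t⁶·c³·(c·∫ da₀ 4π ∫_{ρ>0} radK t a₀ ρ dρ)` with `radK t a₀ ρ = 𝟙{a₀²+ρ²<1}·ρ²·hubFun t a₀ ρ²`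
`= 𝟙·(a₀²+ρ²)^{3/2}/(64ρ) · V_t(a₀, ρ)`, `V_t(a₀,ρ) = vol³(T(ρ²/(a₀²+ρ²), t²(a₀²+ρ²)/(4ρ²), t²(a₀²+ρ²)²/(4ρ⁴)))` (§34).  This file proves the three
estimates from which the logarithm law follows by one-dimensional bookkeeping:
* §35 ★★ DEEP + CUT-OFF region `ρ ∈ (0, a]`: `∫ da₀ ∫_{(0,a]} radK ≤ 2·(√2·a/(64√t))·C_dec` (✓`volume_twoScaleSet4_le_decay`: `κ^{-1/4} = √2ρ/(√t√(a₀²+ρ²))`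
  turns `dρ/ρ` into `dρ/√t`); with `a = A√t` this is `O(A)` UNIFORMLY in `t`;
* §36 ★ OUTER region `ρ > δ`: `∫ da₀ ∫_{ρ>δ} radK ≤ 2·(1/(64δ))·vol³(domSet4)` (✓`volume_domSet4_lt_top`);
* §37 ★★ MIDDLE region `ρ ∈ (a, δ]`, given a two-sided bound `B⁻ ≤ V_t ≤ B⁺` there (to be supplied from ✓`tendsto_volume_twoScale_origin`):
  `B⁻·|a₀|³/64·log(δ/a) ≤ ∫_{(a,δ]} radK t a₀ ≤ B⁺·((a₀²+δ²)^{3/2}/64)·log(δ/a)` — the logarithm, via `∫_{(a,δ]} dρ/ρ = log(δ/a)`.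
HONEST LABEL: finite-dimensional measure theory on `SU(2)⁴` (plan-level zero-mode rung of DRAFT lines); NOT ⟨24497⟩, NOT ⟨24197⟩; the Yang–Mills mass gap
is NOT proved; no summit is proved by a line.  Seat ym-line-fcl-p3 g44 (cell ym-idea-1, free hands), `--supports stmt-QuantumFields-24197`.  Standard axioms
(auxiliary defs `radK`, `Vrad`).  References: [cite: GonzalezarroyoAltes1988]; [cite: Vanbaal2001]; [folklore].
-/

set_option autoImplicit false

noncomputable section

open MeasureTheory Quaternion Set Real
open scoped Quaternion ENNReal BigOperators
open Literature.MathematicalPhysics.QuantumLattice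
open Summit.QuantumFields.YangMills.Theorems.SwapTwistDeficit.ToronLog

attribute [local instance] Literature.Analysis.FluidPDE.Tao2016.quatMeasurableSpace
  Literature.Analysis.FluidPDE.Tao2016.quatBorelSpace
  Literature.MathematicalPhysics.QuantumLattice.secondCountableTopology_su2

namespace Summit.QuantumFields.YangMills.Theorems.SwapVirialDeficit.ZeroModeGroup

/-! ## §34 The radial integrand -/

/-- The radial integrand of part VII: `radK t a₀ ρ = 𝟙{a₀² + ρ² < 1}·ρ²·hubFun t a₀ ρ²`. [folklore] -/
def radK (t r ρ : ℝ) : ℝ≥0∞ := {ρ : ℝ | r ^ 2 + ρ ^ 2 < 1}.indicator (fun ρ => ENNReal.ofReal (ρ ^ 2) * hubFun t r (ρ ^ 2)) ρ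

/-- The volume factor `V_t(a₀, ρ) = vol³(T(ρ²/(a₀²+ρ²), t²(a₀²+ρ²)/(4ρ²), t²(a₀²+ρ²)²/(4ρ⁴)))`. [folklore] -/
def Vrad (t r ρ : ℝ) : ℝ≥0∞ :=
  (((volume : Measure ℍ).prod (volume : Measure ℍ)).prod (volume : Measure ℍ))
    (twoScaleSet4 (ρ ^ 2 / (r ^ 2 + ρ ^ 2)) (t ^ 2 * (r ^ 2 + ρ ^ 2) / (4 * ρ ^ 2)) (t ^ 2 * (r ^ 2 + ρ ^ 2) ^ 2 / (4 * ρ ^ 4)))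

/-- Part VII in this notation: `Haar⁴(N₄(t)) = t⁶·c³·(c·∫ da₀ 4π·∫_{ρ>0} radK t a₀ ρ)`. [folklore] -/
theorem haar_nearlyCommuting_eq_radK {t : ℝ} (ht : 0 < t) :
    (Measure.pi fun _ : Fin 4 => Literature.MathematicalPhysics.QuantumFieldTheory.haarProbability (Matrix.specialUnitaryGroup (Fin 2) ℂ)) (nearlyCommuting t) =
      ENNReal.ofReal (t ^ 6) * ((ENNReal.ofReal coneConst * ENNReal.ofReal coneConst * ENNReal.ofReal coneConst) *
        (ENNReal.ofReal coneConst * ∫⁻ r : ℝ, ENNReal.ofReal (4 * Real.pi) * ∫⁻ ρ in Ioi (0 : ℝ), radK t r ρ)) :=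
  haar_nearlyCommuting_eq_radial ht

/-- ★ The radial integrand made explicit (`ρ > 0`, `a₀² + ρ² < 1`): `radK t a₀ ρ = ((a₀²+ρ²)√(a₀²+ρ²)/(64ρ)) · V_t(a₀, ρ)`. [folklore] -/
theorem radK_eq {t r ρ : ℝ} (hρ : 0 < ρ) (hin : r ^ 2 + ρ ^ 2 < 1) :
    radK t r ρ = ENNReal.ofReal ((r ^ 2 + ρ ^ 2) * Real.sqrt (r ^ 2 + ρ ^ 2) / (64 * ρ)) * Vrad t r ρ := by
  unfold radK Vrad
  rw [Set.indicator_of_mem (show ρ ∈ {ρ : ℝ | r ^ 2 + ρ ^ 2 < 1} from hin), hubFun_sq hρ, ← mul_assoc, ← ENNReal.ofReal_mul (sq_nonneg ρ)]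
  congr 2
  set s := r ^ 2 + ρ ^ 2 with hs
  have hs0 : 0 ≤ s := by positivity
  have e3 : Real.sqrt s ^ 3 = s * Real.sqrt s := by
    rw [pow_succ, Real.sq_sqrt hs0]
  rw [div_pow, e3]
  field_simp
  ring

/-- Off the unit disc or for `ρ` with `a₀² + ρ² ≥ 1` the integrand vanishes. [folklore] -/
theorem radK_eq_zero {t r ρ : ℝ} (h : ¬ r ^ 2 + ρ ^ 2 < 1) : radK t r ρ = 0 := by
  unfold radK; rw [Set.indicator_of_notMem (show ρ ∉ {ρ : ℝ | r ^ 2 + ρ ^ 2 < 1} from h)]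

/-- `V_t ≤ vol³(domSet4)` (`ρ ≠ 0`). [folklore] -/
theorem Vrad_le_domSet4 (t r : ℝ) {ρ : ℝ} (hρ : 0 < ρ) :
    Vrad t r ρ ≤ (((volume : Measure ℍ).prod (volume : Measure ℍ)).prod (volume : Measure ℍ)) domSet4 := by
  unfold Vrad
  exact volume_twoScaleSet4_le_domSet4 (by positivity) (by positivity) (by positivity)

/-- ★ `V_t ≤ C_dec·√2ρ/(√t·√(a₀²+ρ²))` (`t, ρ > 0`) — ✓`volume_twoScaleSet4_le_decay` with `κ^{1/4} = √t√(a₀²+ρ²)/(√2ρ)`. [folklore] -/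
theorem Vrad_le_decay {t r ρ : ℝ} (ht : 0 < t) (hρ : 0 < ρ) :
    Vrad t r ρ ≤ decayConst * ENNReal.ofReal (Real.sqrt 2 * ρ / (Real.sqrt t * Real.sqrt (r ^ 2 + ρ ^ 2))) := by
  have hs : 0 < r ^ 2 + ρ ^ 2 := by positivity
  have hκ : 0 < t ^ 2 * (r ^ 2 + ρ ^ 2) ^ 2 / (4 * ρ ^ 4) := by positivity
  unfold Vrad
  refine (volume_twoScaleSet4_le_decay (by positivity) (by positivity) hκ).trans (le_of_eq ?_)
  congr 2
  -- `(√(√κ))⁻¹ = √2 ρ/(√t √s)`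
  have e1 : Real.sqrt (t ^ 2 * (r ^ 2 + ρ ^ 2) ^ 2 / (4 * ρ ^ 4)) = t * (r ^ 2 + ρ ^ 2) / (2 * ρ ^ 2) := by
    rw [show t ^ 2 * (r ^ 2 + ρ ^ 2) ^ 2 / (4 * ρ ^ 4) = (t * (r ^ 2 + ρ ^ 2) / (2 * ρ ^ 2)) ^ 2 by field_simp; ring]
    exact Real.sqrt_sq (by positivity)
  rw [e1]
  have h2 : Real.sqrt 2 * Real.sqrt 2 = 2 := Real.mul_self_sqrt (by norm_num)
  have e2 : t * (r ^ 2 + ρ ^ 2) / (2 * ρ ^ 2) = (Real.sqrt t * Real.sqrt (r ^ 2 + ρ ^ 2) / (Real.sqrt 2 * ρ)) ^ 2 := by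
    rw [div_pow, mul_pow, mul_pow, Real.sq_sqrt ht.le, Real.sq_sqrt hs.le, Real.sq_sqrt (by norm_num : (0:ℝ) ≤ 2)]
  rw [e2, Real.sqrt_sq (by positivity), inv_div]

/-! ## §35 The deep and cut-off region `ρ ∈ (0, a]` -/

/-- Pointwise: for `ρ ∈ (0, a]`-type points, `radK t a₀ ρ ≤ 𝟙{a₀² < 1}·(√2/(64√t))·C_dec`. [folklore] -/
theorem radK_le_deep {t : ℝ} (ht : 0 < t) (r : ℝ) {ρ : ℝ} (hρ : 0 < ρ) :
    radK t r ρ ≤ {r : ℝ | r ^ 2 < 1}.indicator (fun _ => ENNReal.ofReal (Real.sqrt 2 / (64 * Real.sqrt t)) * decayConst) r := by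
  by_cases hin : r ^ 2 + ρ ^ 2 < 1
  · have hr : r ∈ {r : ℝ | r ^ 2 < 1} := by simp only [Set.mem_setOf_eq]; nlinarith [sq_nonneg ρ]
    rw [Set.indicator_of_mem hr, radK_eq hρ hin]
    have hs : 0 < r ^ 2 + ρ ^ 2 := by positivity
    calc ENNReal.ofReal ((r ^ 2 + ρ ^ 2) * Real.sqrt (r ^ 2 + ρ ^ 2) / (64 * ρ)) * Vrad t r ρ
        ≤ ENNReal.ofReal ((r ^ 2 + ρ ^ 2) * Real.sqrt (r ^ 2 + ρ ^ 2) / (64 * ρ)) *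
            (decayConst * ENNReal.ofReal (Real.sqrt 2 * ρ / (Real.sqrt t * Real.sqrt (r ^ 2 + ρ ^ 2)))) := by
          gcongr; exact Vrad_le_decay ht hρ
      _ = ENNReal.ofReal ((r ^ 2 + ρ ^ 2) * Real.sqrt (r ^ 2 + ρ ^ 2) / (64 * ρ) * (Real.sqrt 2 * ρ / (Real.sqrt t * Real.sqrt (r ^ 2 + ρ ^ 2)))) *
            decayConst := by
          rw [ENNReal.ofReal_mul (by positivity)]; ring
      _ = ENNReal.ofReal (Real.sqrt 2 * (r ^ 2 + ρ ^ 2) / (64 * Real.sqrt t)) * decayConst := by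
          congr 2
          have h1 : Real.sqrt (r ^ 2 + ρ ^ 2) ≠ 0 := (Real.sqrt_pos.2 hs).ne'
          have h2 : Real.sqrt t ≠ 0 := (Real.sqrt_pos.2 ht).ne'
          field_simp
      _ ≤ ENNReal.ofReal (Real.sqrt 2 / (64 * Real.sqrt t)) * decayConst := by
          refine mul_le_mul' ?_ le_rfl
          apply ENNReal.ofReal_le_ofReal
          rw [div_le_div_iff_of_pos_right (by positivity)]
          nlinarith [Real.sqrt_nonneg 2, hin.le]
  · rw [radK_eq_zero hin]; exact zero_le

/-- ★★ **DEEP + CUT-OFF REGION**: `∫ da₀ ∫_{(0,a]} radK t a₀ ρ dρ ≤ 2·(a·√2/(64√t))·C_dec` (`t, a > 0`).  With `a = A√t` the right side is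
`(√2 A/32)·C_dec`, uniformly in `t`. [folklore] -/
theorem lintegral_radK_deep_le {t a : ℝ} (ht : 0 < t) (ha : 0 < a) :
    ∫⁻ r : ℝ, ∫⁻ ρ in Ioc 0 a, radK t r ρ ≤ ENNReal.ofReal 2 * (ENNReal.ofReal (a * (Real.sqrt 2 / (64 * Real.sqrt t))) * decayConst) := by
  have hpt : ∀ r : ℝ, ∫⁻ ρ in Ioc 0 a, radK t r ρ ≤
      {r : ℝ | r ^ 2 < 1}.indicator (fun _ => ENNReal.ofReal (a * (Real.sqrt 2 / (64 * Real.sqrt t))) * decayConst) r := by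
    intro r
    calc ∫⁻ ρ in Ioc 0 a, radK t r ρ
        ≤ ∫⁻ ρ in Ioc 0 a, {r : ℝ | r ^ 2 < 1}.indicator (fun _ => ENNReal.ofReal (Real.sqrt 2 / (64 * Real.sqrt t)) * decayConst) r := by
          refine setLIntegral_mono measurable_const fun ρ hρ => ?_
          exact radK_le_deep ht r hρ.1
      _ = {r : ℝ | r ^ 2 < 1}.indicator (fun _ => ENNReal.ofReal (a * (Real.sqrt 2 / (64 * Real.sqrt t))) * decayConst) r := by
          rw [setLIntegral_const, Real.volume_Ioc, sub_zero]
          by_cases hr : r ∈ {r : ℝ | r ^ 2 < 1}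
          · rw [Set.indicator_of_mem hr, Set.indicator_of_mem hr, mul_comm, ← mul_assoc, ← ENNReal.ofReal_mul ha.le]
          · rw [Set.indicator_of_notMem hr, Set.indicator_of_notMem hr, zero_mul]
  calc ∫⁻ r : ℝ, ∫⁻ ρ in Ioc 0 a, radK t r ρ
      ≤ ∫⁻ r : ℝ, {r : ℝ | r ^ 2 < 1}.indicator (fun _ => ENNReal.ofReal (a * (Real.sqrt 2 / (64 * Real.sqrt t))) * decayConst) r := lintegral_mono hpt
    _ = (ENNReal.ofReal (a * (Real.sqrt 2 / (64 * Real.sqrt t))) * decayConst) * volume {r : ℝ | r ^ 2 < 1} := by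
        have hm1 : MeasurableSet {r : ℝ | r ^ 2 < 1} := measurableSet_lt (measurable_id.pow_const 2) measurable_const
        rw [lintegral_indicator hm1, setLIntegral_const]
    _ = ENNReal.ofReal 2 * (ENNReal.ofReal (a * (Real.sqrt 2 / (64 * Real.sqrt t))) * decayConst) := by
        have e : {r : ℝ | r ^ 2 < 1} = Ioo (-1 : ℝ) 1 := by
          ext r; simp only [Set.mem_setOf_eq, Set.mem_Ioo, sq_lt_one_iff_abs_lt_one, abs_lt]
        rw [e, Real.volume_Ioo, show (1 : ℝ) - -1 = 2 by norm_num, mul_comm]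

/-! ## §36 The outer region `ρ > δ` -/

/-- Pointwise in the outer region: `radK t a₀ ρ ≤ 𝟙{a₀² < 1}·𝟙{ρ < 1}·(1/(64δ))·vol³(domSet4)` for `ρ > δ > 0`. [folklore] -/
theorem radK_le_outer (t r : ℝ) {δ ρ : ℝ} (hδ : 0 < δ) (hρ : δ < ρ) :
    radK t r ρ ≤ {r : ℝ | r ^ 2 < 1}.indicator (fun _ => (Iio (1 : ℝ)).indicator (fun _ => ENNReal.ofReal (1 / (64 * δ)) *
      (((volume : Measure ℍ).prod (volume : Measure ℍ)).prod (volume : Measure ℍ)) domSet4) ρ) r := by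
  have hρ0 : 0 < ρ := hδ.trans hρ
  by_cases hin : r ^ 2 + ρ ^ 2 < 1
  · have hr : r ∈ {r : ℝ | r ^ 2 < 1} := by simp only [Set.mem_setOf_eq]; nlinarith [sq_nonneg ρ]
    have hρ1 : ρ ∈ Iio (1 : ℝ) := by simp only [Set.mem_Iio]; nlinarith [sq_nonneg r]
    rw [Set.indicator_of_mem hr, Set.indicator_of_mem hρ1, radK_eq hρ0 hin]
    have hs1 : Real.sqrt (r ^ 2 + ρ ^ 2) ≤ 1 := by rw [← Real.sqrt_one]; exact Real.sqrt_le_sqrt hin.le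
    have hX : (r ^ 2 + ρ ^ 2) * Real.sqrt (r ^ 2 + ρ ^ 2) ≤ 1 := mul_le_one₀ hin.le (Real.sqrt_nonneg _) hs1
    have hreal : (r ^ 2 + ρ ^ 2) * Real.sqrt (r ^ 2 + ρ ^ 2) / (64 * ρ) ≤ 1 / (64 * δ) := by
      rw [div_le_div_iff₀ (by positivity) (by positivity)]
      nlinarith [hX, hρ.le, hδ.le, mul_nonneg (le_trans (by positivity) hX) hδ.le]
    exact mul_le_mul' (ENNReal.ofReal_le_ofReal hreal) (Vrad_le_domSet4 t r hρ0)
  · rw [radK_eq_zero hin]; exact zero_le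

/-- ★ **OUTER REGION**: `∫ da₀ ∫_{ρ>δ} radK t a₀ ρ dρ ≤ 2·(1/(64δ))·vol³(domSet4)` (`δ > 0`; any `t`). [folklore] -/
theorem lintegral_radK_outer_le (t : ℝ) {δ : ℝ} (hδ : 0 < δ) :
    ∫⁻ r : ℝ, ∫⁻ ρ in Ioi δ, radK t r ρ ≤
      ENNReal.ofReal 2 * (ENNReal.ofReal (1 / (64 * δ)) * (((volume : Measure ℍ).prod (volume : Measure ℍ)).prod (volume : Measure ℍ)) domSet4) := by
  set D := (((volume : Measure ℍ).prod (volume : Measure ℍ)).prod (volume : Measure ℍ)) domSet4 with hD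
  have hpt : ∀ r : ℝ, ∫⁻ ρ in Ioi δ, radK t r ρ ≤ {r : ℝ | r ^ 2 < 1}.indicator (fun _ => ENNReal.ofReal (1 / (64 * δ)) * D) r := by
    intro r
    calc ∫⁻ ρ in Ioi δ, radK t r ρ
        ≤ ∫⁻ ρ in Ioi δ, {r : ℝ | r ^ 2 < 1}.indicator (fun _ => (Iio (1 : ℝ)).indicator (fun _ => ENNReal.ofReal (1 / (64 * δ)) * D) ρ) r := by
          refine setLIntegral_mono ?_ fun ρ hρ => radK_le_outer t r hδ hρ
          by_cases hr : r ∈ {r : ℝ | r ^ 2 < 1}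
          · simp only [Set.indicator_of_mem hr]; exact Measurable.indicator measurable_const measurableSet_Iio
          · simp only [Set.indicator_of_notMem hr]; exact measurable_const
      _ ≤ {r : ℝ | r ^ 2 < 1}.indicator (fun _ => ENNReal.ofReal (1 / (64 * δ)) * D) r := by
          by_cases hr : r ∈ {r : ℝ | r ^ 2 < 1}
          · simp only [Set.indicator_of_mem hr]
            rw [lintegral_indicator measurableSet_Iio, setLIntegral_const, Measure.restrict_apply measurableSet_Iio]
            calc ENNReal.ofReal (1 / (64 * δ)) * D * volume (Iio 1 ∩ Ioi δ) ≤ ENNReal.ofReal (1 / (64 * δ)) * D * 1 := by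
                  gcongr
                  calc volume (Iio (1:ℝ) ∩ Ioi δ) ≤ volume (Ioo δ 1) := by
                        apply measure_mono; rintro ρ ⟨h1, h2⟩; exact ⟨h2, h1⟩
                    _ = ENNReal.ofReal (1 - δ) := Real.volume_Ioo
                    _ ≤ 1 := by rw [← ENNReal.ofReal_one]; exact ENNReal.ofReal_le_ofReal (by linarith)
              _ = _ := mul_one _
          · simp only [Set.indicator_of_notMem hr, lintegral_zero]; exact le_rfl
  calc ∫⁻ r : ℝ, ∫⁻ ρ in Ioi δ, radK t r ρ ≤ ∫⁻ r : ℝ, {r : ℝ | r ^ 2 < 1}.indicator (fun _ => ENNReal.ofReal (1 / (64 * δ)) * D) r :=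
        lintegral_mono hpt
    _ = ENNReal.ofReal (1 / (64 * δ)) * D * volume {r : ℝ | r ^ 2 < 1} := by
        have hm1 : MeasurableSet {r : ℝ | r ^ 2 < 1} := measurableSet_lt (measurable_id.pow_const 2) measurable_const
        rw [lintegral_indicator hm1, setLIntegral_const]
    _ = ENNReal.ofReal 2 * (ENNReal.ofReal (1 / (64 * δ)) * D) := by
        have e : {r : ℝ | r ^ 2 < 1} = Ioo (-1 : ℝ) 1 := by
          ext r; simp only [Set.mem_setOf_eq, Set.mem_Ioo, sq_lt_one_iff_abs_lt_one, abs_lt]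
        rw [e, Real.volume_Ioo, show (1 : ℝ) - -1 = 2 by norm_num, mul_comm]

/-! ## §37 The middle region `ρ ∈ (a, δ]`: the logarithm -/

/-- `∫_{(a,δ]} dρ/ρ = log(δ/a)` as a Lebesgue integral (`0 < a ≤ δ`). [folklore] -/
theorem lintegral_inv_Ioc {a δ : ℝ} (ha : 0 < a) (hδ : a ≤ δ) :
    ∫⁻ ρ in Ioc a δ, ENNReal.ofReal (ρ⁻¹) = ENNReal.ofReal (Real.log (δ / a)) := by
  have hint : IntegrableOn (fun ρ : ℝ => ρ⁻¹) (Ioc a δ) := by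
    refine (ContinuousOn.integrableOn_Icc (continuousOn_inv₀.mono ?_)).mono_set Ioc_subset_Icc_self
    intro ρ hρ; simp only [Set.mem_compl_iff, Set.mem_singleton_iff]; exact (ha.trans_le hρ.1).ne'
  have hnn : 0 ≤ᵐ[volume.restrict (Ioc a δ)] fun ρ : ℝ => ρ⁻¹ := by
    filter_upwards [ae_restrict_mem measurableSet_Ioc] with ρ hρ
    exact inv_nonneg.2 (ha.le.trans hρ.1.le)
  rw [← ofReal_integral_eq_lintegral_ofReal hint hnn, ← intervalIntegral.integral_of_le hδ, integral_inv_of_pos ha (ha.trans_le hδ)]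

/-- ★★ **MIDDLE REGION, upper bound**: if `V_t(a₀, ρ) ≤ B` for `ρ ∈ (a, δ]` then
`∫_{(a,δ]} radK t a₀ ρ dρ ≤ ((a₀²+δ²)√(a₀²+δ²)/64)·log(δ/a) · B` (`0 < a ≤ δ`). [folklore] -/
theorem lintegral_radK_middle_le {t r a δ : ℝ} (ha : 0 < a) (hδ : a ≤ δ) {B : ℝ≥0∞}
    (hV : ∀ ρ : ℝ, ρ ∈ Ioc a δ → r ^ 2 + ρ ^ 2 < 1 → Vrad t r ρ ≤ B) :
    ∫⁻ ρ in Ioc a δ, radK t r ρ ≤ ENNReal.ofReal ((r ^ 2 + δ ^ 2) * Real.sqrt (r ^ 2 + δ ^ 2) / 64 * Real.log (δ / a)) * B := by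
  have hpt : ∀ ρ : ℝ, ρ ∈ Ioc a δ → radK t r ρ ≤ ENNReal.ofReal ((r ^ 2 + δ ^ 2) * Real.sqrt (r ^ 2 + δ ^ 2) / 64) * ENNReal.ofReal (ρ⁻¹) * B := by
    intro ρ hρ
    have hρ0 : 0 < ρ := ha.trans hρ.1
    by_cases hin : r ^ 2 + ρ ^ 2 < 1
    · rw [radK_eq hρ0 hin]
      have hsd : r ^ 2 + ρ ^ 2 ≤ r ^ 2 + δ ^ 2 := by nlinarith [hρ.2, hρ0.le, ha.le]
      have hreal : (r ^ 2 + ρ ^ 2) * Real.sqrt (r ^ 2 + ρ ^ 2) / (64 * ρ) ≤ (r ^ 2 + δ ^ 2) * Real.sqrt (r ^ 2 + δ ^ 2) / (64 * ρ) :=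
        div_le_div_of_nonneg_right (mul_le_mul hsd (Real.sqrt_le_sqrt hsd) (Real.sqrt_nonneg _) (by positivity)) (by positivity)
      calc ENNReal.ofReal ((r ^ 2 + ρ ^ 2) * Real.sqrt (r ^ 2 + ρ ^ 2) / (64 * ρ)) * Vrad t r ρ
          ≤ ENNReal.ofReal ((r ^ 2 + δ ^ 2) * Real.sqrt (r ^ 2 + δ ^ 2) / (64 * ρ)) * B :=
            mul_le_mul' (ENNReal.ofReal_le_ofReal hreal) (hV ρ hρ hin)
        _ = ENNReal.ofReal ((r ^ 2 + δ ^ 2) * Real.sqrt (r ^ 2 + δ ^ 2) / 64) * ENNReal.ofReal (ρ⁻¹) * B := by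
            rw [← ENNReal.ofReal_mul (by positivity)]; congr 2; field_simp
    · rw [radK_eq_zero hin]; exact zero_le
  calc ∫⁻ ρ in Ioc a δ, radK t r ρ
      ≤ ∫⁻ ρ in Ioc a δ, ENNReal.ofReal ((r ^ 2 + δ ^ 2) * Real.sqrt (r ^ 2 + δ ^ 2) / 64) * ENNReal.ofReal (ρ⁻¹) * B :=
        setLIntegral_mono ((measurable_const.mul (ENNReal.measurable_ofReal.comp measurable_inv)).mul measurable_const) hpt
    _ = ENNReal.ofReal ((r ^ 2 + δ ^ 2) * Real.sqrt (r ^ 2 + δ ^ 2) / 64) * (∫⁻ ρ in Ioc a δ, ENNReal.ofReal (ρ⁻¹)) * B := by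
        have hm2 : Measurable fun ρ : ℝ => ENNReal.ofReal (ρ⁻¹) := ENNReal.measurable_ofReal.comp measurable_inv
        have hm : Measurable fun ρ : ℝ => ENNReal.ofReal ((r ^ 2 + δ ^ 2) * Real.sqrt (r ^ 2 + δ ^ 2) / 64) * ENNReal.ofReal (ρ⁻¹) :=
          measurable_const.mul hm2
        rw [lintegral_mul_const _ hm, lintegral_const_mul _ hm2]
    _ = _ := by
        rw [lintegral_inv_Ioc ha hδ, ← ENNReal.ofReal_mul (by positivity)]

/-- ★★ **MIDDLE REGION, lower bound**: if `B ≤ V_t(a₀, ρ)` for `ρ ∈ (a, δ]` and `a₀² + δ² < 1`, then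
`(|a₀|³/64)·log(δ/a) · B ≤ ∫_{(a,δ]} radK t a₀ ρ dρ` (`0 < a ≤ δ`). [folklore] -/
theorem le_lintegral_radK_middle {t r a δ : ℝ} (ha : 0 < a) (hδ : a ≤ δ) (hrδ : r ^ 2 + δ ^ 2 < 1) {B : ℝ≥0∞}
    (hV : ∀ ρ : ℝ, ρ ∈ Ioc a δ → B ≤ Vrad t r ρ) :
    ENNReal.ofReal (|r| ^ 3 / 64 * Real.log (δ / a)) * B ≤ ∫⁻ ρ in Ioc a δ, radK t r ρ := by
  have hpt : ∀ ρ : ℝ, ρ ∈ Ioc a δ → ENNReal.ofReal (|r| ^ 3 / 64) * ENNReal.ofReal (ρ⁻¹) * B ≤ radK t r ρ := by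
    intro ρ hρ
    have hρ0 : 0 < ρ := ha.trans hρ.1
    have hin : r ^ 2 + ρ ^ 2 < 1 := by nlinarith [hρ.2, hρ0.le]
    rw [radK_eq hρ0 hin, ← ENNReal.ofReal_mul (by positivity)]
    gcongr
    · -- `|r|³/(64) · ρ⁻¹ ≤ (r²+ρ²)√(r²+ρ²)/(64ρ)`
      have h1 : |r| ^ 2 ≤ r ^ 2 + ρ ^ 2 := by rw [sq_abs]; nlinarith [sq_nonneg ρ]
      have h2 : |r| ≤ Real.sqrt (r ^ 2 + ρ ^ 2) := by rw [← Real.sqrt_sq (abs_nonneg r)]; exact Real.sqrt_le_sqrt h1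
      have h3 : |r| ^ 3 ≤ (r ^ 2 + ρ ^ 2) * Real.sqrt (r ^ 2 + ρ ^ 2) := by
        rw [pow_succ]; exact mul_le_mul h1 h2 (abs_nonneg r) (by positivity)
      rw [show |r| ^ 3 / 64 * ρ⁻¹ = |r| ^ 3 / (64 * ρ) by field_simp]
      exact div_le_div_of_nonneg_right h3 (by positivity)
    · exact hV ρ hρ
  calc ENNReal.ofReal (|r| ^ 3 / 64 * Real.log (δ / a)) * B
      = ENNReal.ofReal (|r| ^ 3 / 64) * (∫⁻ ρ in Ioc a δ, ENNReal.ofReal (ρ⁻¹)) * B := by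
        rw [lintegral_inv_Ioc ha hδ, ← ENNReal.ofReal_mul (by positivity)]
    _ = ∫⁻ ρ in Ioc a δ, ENNReal.ofReal (|r| ^ 3 / 64) * ENNReal.ofReal (ρ⁻¹) * B := by
        have hm2 : Measurable fun ρ : ℝ => ENNReal.ofReal (ρ⁻¹) := ENNReal.measurable_ofReal.comp measurable_inv
        have hm : Measurable fun ρ : ℝ => ENNReal.ofReal (|r| ^ 3 / 64) * ENNReal.ofReal (ρ⁻¹) := measurable_const.mul hm2
        rw [lintegral_mul_const _ hm, lintegral_const_mul _ hm2]
    _ ≤ ∫⁻ ρ in Ioc a δ, radK t r ρ := by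
        refine setLIntegral_mono' measurableSet_Ioc fun ρ hρ => hpt ρ hρ

end Summit.QuantumFields.YangMills.Theorems.SwapVirialDeficit.ZeroModeGroup

end
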